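import Summits.Ventures.YMGap.FlowData.TubeTransferAnisotropic
import Summits.Ventures.YMGap.FlowData.TubeVacuumSector
import HarnessLib

/-!
# Venture YMGap, track Y3 FLOW-DATA — the cell's `SU(2)` anisotropic tube operator: `T_{β/2,β/2} = su2TubeTransferOperator β`,
# and the temporal / spatial Hellmann–Feynman identities at `(β_t/2, β_s/2)` (theorems only)

HONEST FRAMING: venture file of the cell `pub-ymgap` (QuantumFields programme), track Y3; the `SU(2)`, fundamental-
representation instances of `TubeTransferAnisotropic.lean` (FLOW-PLAN O7's `P_t` / `P_s` channels, typed).  One operator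
family on a fixed spatial torus; no number, no row; nothing about `L → ∞`, the continuum or a mass gap.

References: T. Kato (1966) VIII-§2.3 [cite: Kato1966, VIII-§2.3 Theorem 2.6]; M. Lüscher, Commun. Math. Phys. 54 (1977) 283
[cite: Luscher1977]; M. Reed, B. Simon IV (1978) XIII.12 [cite: ReedSimonIV1978, Thm XIII.44].
-/

noncomputable section

open scoped RealInnerProductSpace
open MeasureTheory
open Literature.MathematicalPhysics.QuantumFieldTheory Literature.Analysis.OperatorTheory
open Literature.MathematicalPhysics.QuantumLattice (fundamentalRep continuous_fundamentalRep fundamentalRep_mem_unitaryGroup)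

namespace Summit.Ventures.YMGap.FlowData

section SU2

variable (k L : ℕ) [NeZero L]

/-- At equal couplings the anisotropic SU(2) operator IS the cell's `su2TubeTransferOperator β k L`. [folklore] -/
theorem su2_tubeTransferOperatorAniso_self (β : ℝ) :
    tubeTransferOperatorAniso (fundamentalRep (Fin 2)) (β / 2) (β / 2) k L = su2TubeTransferOperator β k L := by
  haveI : SecondCountableTopology (Matrix.specialUnitaryGroup (Fin 2) ℂ) :=
    Literature.MathematicalPhysics.QuantumLattice.secondCountableTopology_su2
  exact tubeTransferOperatorAniso_self (ρ := fundamentalRep (Fin 2)) k L (continuous_fundamentalRep (Fin 2)) (β / 2)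

/-- ★ **The cell's temporal Hellmann–Feynman identity**: for `β_t > 0`, `β_s ≥ 0`, `J_E ↦ log ‖T_{J_E, β_s/2}‖` is
differentiable at `β_t/2` with the Hellmann–Feynman value on the positive top eigenvector (O7 `P_t` channel, typed).
[cite: Kato1966, VIII-§2.3 Theorem 2.6 (2.17)] -/
theorem su2_hasDerivAt_log_norm_elec {βt βs : ℝ} (hβt : 0 < βt) (hβs : 0 ≤ βs) :
    ∃ (T' : Lp ℝ 2 (sliceMeasure (Matrix.specialUnitaryGroup (Fin 2) ℂ) k L) →L[ℝ]
        Lp ℝ 2 (sliceMeasure (Matrix.specialUnitaryGroup (Fin 2) ℂ) k L))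
      (φ : Lp ℝ 2 (sliceMeasure (Matrix.specialUnitaryGroup (Fin 2) ℂ) k L)),
      HasDerivAt (fun JE => tubeTransferOperatorAniso (fundamentalRep (Fin 2)) JE (βs / 2) k L) T' (βt / 2) ∧
      ‖φ‖ = 1 ∧ IsStrictlyPositiveFun φ ∧
      tubeTransferOperatorAniso (fundamentalRep (Fin 2)) (βt / 2) (βs / 2) k L φ =
        ‖tubeTransferOperatorAniso (fundamentalRep (Fin 2)) (βt / 2) (βs / 2) k L‖ • φ ∧
      HasDerivAt (fun JE => Real.log ‖tubeTransferOperatorAniso (fundamentalRep (Fin 2)) JE (βs / 2) k L‖)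
        (⟪φ, T' φ⟫ / ‖tubeTransferOperatorAniso (fundamentalRep (Fin 2)) (βt / 2) (βs / 2) k L‖) (βt / 2) := by
  haveI : SecondCountableTopology (Matrix.specialUnitaryGroup (Fin 2) ℂ) :=
    Literature.MathematicalPhysics.QuantumLattice.secondCountableTopology_su2
  obtain ⟨T', φ, h1, h2, h3, h4, h5, -⟩ := tubeTransferOperatorAniso_hasDerivAt_log_norm_elec (fundamentalRep (Fin 2)) k L
    (continuous_fundamentalRep (Fin 2)) fundamentalRep_mem_unitaryGroup (JE₀ := βt / 2) (JM := βs / 2)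
    (by linarith) (by linarith)
  exact ⟨T', φ, h1, h2, h3, h4, h5⟩

/-- ★ **The cell's spatial Hellmann–Feynman identity**: for `β_t ≥ 0`, `β_s > 0`, `J_M ↦ log ‖T_{β_t/2, J_M}‖` is
differentiable at `β_s/2` with the Hellmann–Feynman value on the positive top eigenvector (O7 `P_s` channel, typed).
[cite: Kato1966, VIII-§2.3 Theorem 2.6 (2.17)] -/
theorem su2_hasDerivAt_log_norm_mag {βt βs : ℝ} (hβt : 0 ≤ βt) (hβs : 0 < βs) :
    ∃ (T' : Lp ℝ 2 (sliceMeasure (Matrix.specialUnitaryGroup (Fin 2) ℂ) k L) →L[ℝ]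
        Lp ℝ 2 (sliceMeasure (Matrix.specialUnitaryGroup (Fin 2) ℂ) k L))
      (φ : Lp ℝ 2 (sliceMeasure (Matrix.specialUnitaryGroup (Fin 2) ℂ) k L)),
      HasDerivAt (fun JM => tubeTransferOperatorAniso (fundamentalRep (Fin 2)) (βt / 2) JM k L) T' (βs / 2) ∧
      ‖φ‖ = 1 ∧ IsStrictlyPositiveFun φ ∧
      tubeTransferOperatorAniso (fundamentalRep (Fin 2)) (βt / 2) (βs / 2) k L φ =
        ‖tubeTransferOperatorAniso (fundamentalRep (Fin 2)) (βt / 2) (βs / 2) k L‖ • φ ∧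
      HasDerivAt (fun JM => Real.log ‖tubeTransferOperatorAniso (fundamentalRep (Fin 2)) (βt / 2) JM k L‖)
        (⟪φ, T' φ⟫ / ‖tubeTransferOperatorAniso (fundamentalRep (Fin 2)) (βt / 2) (βs / 2) k L‖) (βs / 2) := by
  haveI : SecondCountableTopology (Matrix.specialUnitaryGroup (Fin 2) ℂ) :=
    Literature.MathematicalPhysics.QuantumLattice.secondCountableTopology_su2
  obtain ⟨T', φ, h1, h2, h3, h4, h5, -⟩ := tubeTransferOperatorAniso_hasDerivAt_log_norm_mag (fundamentalRep (Fin 2)) k L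
    (continuous_fundamentalRep (Fin 2)) fundamentalRep_mem_unitaryGroup (JE := βt / 2) (JM₀ := βs / 2)
    (by linarith) (by linarith)
  exact ⟨T', φ, h1, h2, h3, h4, h5⟩

end SU2

end Summit.Ventures.YMGap.FlowData
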